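import Literature.NumberTheory.LFunctions.SmoothedExplicitFormulaContour
import Literature.NumberTheory.LFunctions.ExplicitFormulaPsiCharZeros
import Literature.NumberTheory.LFunctions.ExplicitFormulaPsiChar
import HarnessLib

/-!
# The smoothed explicit formula for `L(s, χ)`, I: the prime side and the contour identity

Topic `Literature/NumberTheory/LFunctions`, sub-namespace `ExplicitPsiChar`. Everything in this
file is PROVED; the two definitions (`charFordK`, `charEFIntegrand`) are glue. This is the character
analogue of the tree's `SmoothedExplicitFormulaPrimeSide.lean` / `SmoothedExplicitFormulaContour.lean`
(Ford 2002 Lemma 4.5, Kadiri 2005 Prop. 2.1 for `ζ`), i.e. the contour argument behind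

* D. R. Heath-Brown, *Zero-free regions for Dirichlet `L`-functions, and the least prime in an
  arithmetic progression*, PLMS 64 (1992), **Lemma 5.1** and (5.6)–(5.7):
  `Σ Λ(n) χ(n) n^{-s} f(L⁻¹ log n) = −L Σ_ρ F₀((s−ρ)L) − f(0) L'/L(s, χ) + (left line)`.

For a Dirichlet character `χ` mod `q` and a continuous compactly supported `f`:

* `charFordK χ f s = Σ_n Λ(n) χ(n) f(log n) n^{-s}` and the **prime side**
  `∫_ℝ (−L'/L)(α + iv, χ) F₀(s − α − iv) dv = 2π K_{f,χ}(s)` for `1 < α`, `Re s < α`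
  (`integral_logDeriv_LFunction_mul_fordLaplace₀`; termwise Mellin inversion exactly as for `ζ`,
  `|χ(n)| ≤ 1`);
* `charEFIntegrand χ f s w = (−L'/L)(w, χ) F₀(s − w)` and, for PRIMITIVE `χ` mod `q > 1`, the
  **contour identity** on `K = [−5/2, 3/2] × [−T, T]` at a good height `T`
  (`charEF_contour_identity`): `∮_{∂K} G = 2πi (−f(0) L'/L(s, χ) − Σ_{ρ} m(ρ) F₀(s − ρ))`, the sum over
  ALL zeros `ρ` of `L(·, χ)` in `K` — the non-trivial ones with `|Im ρ| ≤ T` and the trivial ones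
  `0, −2` (even `χ`) or `−1` (odd `χ`) — with `m = DirichletDisc.zeroOrder χ`; `s ∈ K°` with
  `L(s, χ) ≠ 0` contributes the residue `−f(0) L'/L(s, χ)` of the simple pole of `F₀(s − w)`. (There is
  no pole at `w = 1`. The left line is put at `Re w = −5/2` because the tree bounds `L'/L` there
  uniformly in `Im w`, `ExplicitPsiChar.exists_norm_logDeriv_LFunction_farLeft_le`.)

The limit `T → ∞` and the resulting exact formula are in `SmoothedExplicitFormulaChar.lean`.

## References

* D. R. Heath-Brown, Proc. London Math. Soc. (3) 64 (1992), Lemma 5.1, (5.6)–(5.7).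
  [cite: HeathBrown1992PLMS, Lemma 5.1]
* K. Ford, *Zero-free regions for the Riemann zeta function* (2002), Lemma 4.5 (the method).
  [cite: Ford2002Millennium, Lemma 4.5]
-/

noncomputable section

open Complex Real MeasureTheory Set Filter Topology ArithmeticFunction
open scoped LSeries.notation

namespace Literature.NumberTheory.LFunctions

namespace ExplicitPsiChar

variable {q : ℕ}

/-! ## The smoothed prime sum `K_{f,χ}(s)` -/

/-- `K_{f,χ}(s) = Σ_{n ≥ 1} Λ(n) χ(n) f(log n) n^{-s}` (Heath-Brown's `Σ Λ(n)χ(n)n^{-s} f(L⁻¹log n)`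
with `f(L⁻¹ ·)` in place of `f`). [cite: HeathBrown1992PLMS, Lemma 5.1] -/
def charFordK (χ : DirichletCharacter ℂ q) (f : ℝ → ℝ) (s : ℂ) : ℂ :=
  ∑' n : ℕ, ((Λ n : ℝ) : ℂ) * χ n * (f (Real.log n) : ℂ) * (n : ℂ) ^ (-s)

/-- If `f` vanishes on `[x₀, ∞)` and `x₀ ≤ log N` (`N ≥ 1`), then `K_{f,χ}(s)` is the finite sum
over `n < N`. [folklore] -/
theorem charFordK_eq_sum (χ : DirichletCharacter ℂ q) {f : ℝ → ℝ} {x₀ : ℝ}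
    (hf : ∀ u, x₀ ≤ u → f u = 0) {N : ℕ} (hN : 1 ≤ N) (hx : x₀ ≤ Real.log N) (s : ℂ) :
    charFordK χ f s = ∑ n ∈ Finset.range N,
      ((Λ n : ℝ) : ℂ) * χ n * (f (Real.log n) : ℂ) * (n : ℂ) ^ (-s) := by
  rw [charFordK, tsum_eq_sum]
  intro n hn
  rw [Finset.mem_range, not_lt] at hn
  have hn1 : (1 : ℝ) ≤ n := by exact_mod_cast hN.trans hn
  have hlog : x₀ ≤ Real.log n :=
    hx.trans (Real.log_le_log (by exact_mod_cast hN) (by exact_mod_cast hn))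
  simp [hf _ hlog]

/-! ## The prime side -/

section primeSide

variable (χ : DirichletCharacter ℂ q) {f : ℝ → ℝ} {x₀ : ℝ} {s : ℂ} {α : ℝ}

/-- `‖χ(n)Λ(n) n^{-w}‖ ≤ ‖Λ(n) n^{-Re w}‖`. [folklore] -/
theorem norm_term_twist_le_re (w : ℂ) (n : ℕ) :
    ‖LSeries.term (↗χ * ↗Λ) w n‖ ≤ ‖LSeries.term (fun n ↦ ((Λ n : ℝ) : ℂ)) (w.re : ℂ) n‖ := by
  rcases Nat.eq_zero_or_pos n with rfl | hn
  · simp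
  rw [LSeries.term_of_ne_zero hn.ne', LSeries.term_of_ne_zero hn.ne', norm_div, norm_div,
    Pi.mul_apply, norm_mul, Complex.norm_natCast_cpow_of_pos hn, Complex.norm_natCast_cpow_of_pos hn,
    Complex.ofReal_re]
  refine div_le_div_of_nonneg_right ?_ (by positivity)
  calc ‖(χ n : ℂ)‖ * ‖((Λ n : ℝ) : ℂ)‖ ≤ 1 * ‖((Λ n : ℝ) : ℂ)‖ := by
        gcongr; exact DirichletCharacter.norm_le_one χ _
    _ = ‖((Λ n : ℝ) : ℂ)‖ := one_mul _

/-- The `n`-th term `v ↦ χ(n)Λ(n) n^{-(α+iv)} F₀(s − α − iv)` is integrable. [folklore] -/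
theorem integrable_term_twist_mul_fordLaplace₀
    (hF : Integrable fun v : ℝ ↦ fordLaplace₀ f (s - (α + v * I))) (n : ℕ) :
    Integrable fun v : ℝ ↦ LSeries.term (↗χ * ↗Λ) (α + v * I) n * fordLaplace₀ f (s - (α + v * I)) := by
  rcases Nat.eq_zero_or_pos n with rfl | hn
  · simp only [LSeries.term_zero, zero_mul]
    exact integrable_zero _ _ _
  have hn0 : (n : ℂ) ≠ 0 := by exact_mod_cast hn.ne'
  have hcont : Continuous fun v : ℝ ↦ (n : ℂ) ^ (-((α : ℂ) + v * I)) :=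
    (by fun_prop : Continuous fun v : ℝ ↦ -((α : ℂ) + v * I)).const_cpow (Or.inl hn0)
  have hbdd : ∀ v : ℝ, ‖(n : ℂ) ^ (-((α : ℂ) + v * I))‖ ≤ (n : ℝ) ^ (-α) := by
    intro v
    rw [norm_natCast_cpow_of_pos hn]
    simp
  have h := (hF.bdd_mul hcont.aestronglyMeasurable (ae_of_all _ hbdd)).const_mul
    ((χ n : ℂ) * ((Λ n : ℝ) : ℂ))
  refine h.congr (Eventually.of_forall fun v ↦ ?_)
  simp only [LSeries.term_of_ne_zero hn.ne', Pi.mul_apply, div_eq_mul_inv, ← cpow_neg]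
  ring

/-- `v ↦ L(χΛ, α + iv)` is continuous (`α > 1`). [folklore] -/
theorem continuous_LSeries_twist_vertical (hα : 1 < α) :
    Continuous fun v : ℝ ↦ L (↗χ * ↗Λ) (α + v * I) := by
  have hsum : Summable fun n ↦ ‖LSeries.term (fun n ↦ ((Λ n : ℝ) : ℂ)) (α : ℂ) n‖ :=
    summable_norm_iff.mpr (ArithmeticFunction.LSeriesSummable_vonMangoldt (by simp [hα]))
  refine continuous_tsum (fun n ↦ ?_) hsum fun n v ↦ ?_
  · rcases Nat.eq_zero_or_pos n with rfl | hn
    · simp only [LSeries.term_zero]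
      exact continuous_const
    · simp only [LSeries.term_of_ne_zero hn.ne']
      have hn0 : (n : ℂ) ≠ 0 := by exact_mod_cast hn.ne'
      refine continuous_const.div ((by fun_prop : Continuous fun v : ℝ ↦ (α : ℂ) + v * I).const_cpow
        (Or.inl hn0)) fun v ↦ ?_
      exact cpow_ne_zero_iff.mpr (Or.inl hn0)
  · have h := norm_term_twist_le_re χ ((α : ℂ) + v * I) n
    simpa using h

/-- `‖L(χΛ, α + iv)‖ ≤ Σ Λ(n) n^{-α}` (`α > 1`). [folklore] -/
theorem norm_LSeries_twist_vertical_le (hα : 1 < α) (v : ℝ) :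
    ‖L (↗χ * ↗Λ) (α + v * I)‖ ≤ ∑' n, ‖LSeries.term (fun n ↦ ((Λ n : ℝ) : ℂ)) (α : ℂ) n‖ := by
  have hsum : Summable fun n ↦ ‖LSeries.term (fun n ↦ ((Λ n : ℝ) : ℂ)) (α : ℂ) n‖ :=
    summable_norm_iff.mpr (ArithmeticFunction.LSeriesSummable_vonMangoldt (by simp [hα]))
  have hle : ∀ n, ‖LSeries.term (↗χ * ↗Λ) (α + v * I) n‖ ≤
      ‖LSeries.term (fun n ↦ ((Λ n : ℝ) : ℂ)) (α : ℂ) n‖ := fun n ↦ by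
    simpa using norm_term_twist_le_re χ ((α : ℂ) + v * I) n
  have hsum' : Summable fun n ↦ ‖LSeries.term (↗χ * ↗Λ) (α + v * I) n‖ :=
    Summable.of_nonneg_of_le (fun _ ↦ norm_nonneg _) hle hsum
  exact (norm_tsum_le_tsum_norm hsum').trans (Summable.tsum_le_tsum hle hsum' hsum)

/-- The integrand `v ↦ L(χΛ, α + iv) F₀(s − α − iv)` of the prime side is integrable. [folklore] -/
theorem integrable_LSeries_twist_mul_fordLaplace₀ (hα : 1 < α)
    (hint : Integrable fun y : ℝ ↦ fordLaplace₀ f ((s.re - α : ℝ) + y * I)) :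
    Integrable fun v : ℝ ↦ L (↗χ * ↗Λ) (α + v * I) * fordLaplace₀ f (s - (α + v * I)) :=
  (integrable_fordLaplace₀_sub hint).bdd_mul
    (continuous_LSeries_twist_vertical χ hα).aestronglyMeasurable
    (ae_of_all _ (norm_LSeries_twist_vertical_le χ hα))

/-- **The prime side for `χ`**: for `f` continuous vanishing on `[x₀, ∞)`, `1 < α`, `Re s < α` and
`F₀` integrable on `Re u = Re s − α`,
`∫_ℝ L(χΛ, α + iv) F₀(s − α − iv) dv = 2π K_{f,χ}(s)` (termwise, by Mellin inversion).
[cite: HeathBrown1992PLMS, Lemma 5.1 (proof)] -/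
theorem integral_LSeries_twist_mul_fordLaplace₀ (hfc : Continuous f)
    (hf0 : ∀ u, x₀ ≤ u → f u = 0) (hα : 1 < α) (hσ : s.re < α)
    (hint : Integrable fun y : ℝ ↦ fordLaplace₀ f ((s.re - α : ℝ) + y * I)) :
    ∫ v : ℝ, L (↗χ * ↗Λ) (α + v * I) * fordLaplace₀ f (s - (α + v * I))
      = 2 * π * charFordK χ f s := by
  have hf1 : ∀ u, max x₀ 0 ≤ u → f u = 0 := fun u hu ↦ hf0 u ((le_max_left _ _).trans hu)
  have hx₁ : 0 ≤ max x₀ 0 := le_max_right _ _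
  have hF := integrable_fordLaplace₀_sub hint
  set Fn : ℕ → ℝ → ℂ := fun n v ↦ LSeries.term (↗χ * ↗Λ) (α + v * I) n
    * fordLaplace₀ f (s - (α + v * I)) with hFn
  have hF_int : ∀ n, Integrable (Fn n) := integrable_term_twist_mul_fordLaplace₀ χ hF
  have hsumα : Summable fun n ↦ ‖LSeries.term (fun n ↦ ((Λ n : ℝ) : ℂ)) (α : ℂ) n‖ :=
    summable_norm_iff.mpr (ArithmeticFunction.LSeriesSummable_vonMangoldt (by simp [hα]))
  have hF_sum : Summable fun n ↦ ∫ v, ‖Fn n v‖ := by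
    refine Summable.of_nonneg_of_le (fun n ↦ integral_nonneg fun v ↦ norm_nonneg _) (fun n ↦ ?_)
      (hsumα.mul_right (∫ v : ℝ, ‖fordLaplace₀ f (s - (α + v * I))‖))
    have hle : ∀ v, ‖Fn n v‖ ≤ ‖LSeries.term (fun n ↦ ((Λ n : ℝ) : ℂ)) (α : ℂ) n‖ *
        ‖fordLaplace₀ f (s - (α + v * I))‖ := by
      intro v
      rw [hFn, norm_mul]
      refine mul_le_mul_of_nonneg_right ?_ (norm_nonneg _)
      simpa using norm_term_twist_le_re χ ((α : ℂ) + v * I) n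
    calc ∫ v : ℝ, ‖Fn n v‖ ≤ ∫ v : ℝ, ‖LSeries.term (fun n ↦ ((Λ n : ℝ) : ℂ)) (α : ℂ) n‖ *
          ‖fordLaplace₀ f (s - (α + v * I))‖ :=
          integral_mono (hF_int n).norm (hF.norm.const_mul _) hle
      _ = ‖LSeries.term (fun n ↦ ((Λ n : ℝ) : ℂ)) (α : ℂ) n‖ *
          ∫ v : ℝ, ‖fordLaplace₀ f (s - (α + v * I))‖ := integral_const_mul _ _
  have hterm : ∀ n, ∫ v, Fn n v =
      ((Λ n : ℝ) : ℂ) * χ n * (2 * π * (f (Real.log n) : ℂ) * (n : ℂ) ^ (-s)) := by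
    intro n
    rcases Nat.eq_zero_or_pos n with rfl | hn
    · have h0 : Fn 0 = fun _ ↦ 0 := by
        funext v
        simp only [hFn, LSeries.term_zero, zero_mul]
      rw [h0, integral_zero]
      simp
    · have h := integral_cpow_neg_mul_fordLaplace₀_eq hfc hf1 hx₁ hσ hint (Nat.one_le_of_lt hn)
      have h' : Fn n = fun v : ℝ ↦ (((Λ n : ℝ) : ℂ) * χ n)
          * ((n : ℂ) ^ (-((α : ℂ) + v * I)) * fordLaplace₀ f (s - (α + v * I))) := by
        funext v
        simp only [hFn, LSeries.term_of_ne_zero hn.ne', Pi.mul_apply, div_eq_mul_inv, ← cpow_neg]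
        ring
      rw [h', integral_const_mul, h]
  calc ∫ v : ℝ, L (↗χ * ↗Λ) (α + v * I) * fordLaplace₀ f (s - (α + v * I))
      = ∫ v, ∑' n, Fn n v := by
        refine integral_congr_ae (ae_of_all _ fun v ↦ ?_)
        simp only [hFn, LSeries, tsum_mul_right]
    _ = ∑' n, ∫ v, Fn n v := (integral_tsum_of_summable_integral_norm hF_int hF_sum).symm
    _ = ∑' n, ((Λ n : ℝ) : ℂ) * χ n * (2 * π * (f (Real.log n) : ℂ) * (n : ℂ) ^ (-s)) := tsum_congr hterm
    _ = 2 * π * charFordK χ f s := by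
        rw [charFordK, ← tsum_mul_left]
        refine tsum_congr fun n ↦ ?_
        ring

variable [NeZero q] in
/-- **The prime side, with `L'/L`**: `∫_ℝ (−L'/L)(α + iv, χ) F₀(s − α − iv) dv = 2π K_{f,χ}(s)` for
`1 < α`, `Re s < α`. [cite: HeathBrown1992PLMS, Lemma 5.1 (proof, (5.6))] -/
theorem integral_logDeriv_LFunction_mul_fordLaplace₀ (hfc : Continuous f)
    (hf0 : ∀ u, x₀ ≤ u → f u = 0) (hα : 1 < α) (hσ : s.re < α)
    (hint : Integrable fun y : ℝ ↦ fordLaplace₀ f ((s.re - α : ℝ) + y * I)) :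
    ∫ v : ℝ, -(deriv χ.LFunction (α + v * I) / χ.LFunction (α + v * I)) *
        fordLaplace₀ f (s - (α + v * I)) = 2 * π * charFordK χ f s := by
  rw [← integral_LSeries_twist_mul_fordLaplace₀ χ hfc hf0 hα hσ hint]
  refine integral_congr_ae (ae_of_all _ fun v ↦ ?_)
  dsimp only
  have h1 : 1 < ((α : ℂ) + v * I).re := by simp [hα]
  rw [DirichletCharacter.LSeries_twist_vonMangoldt_eq χ h1, neg_div,
    DirichletCharacter.deriv_LFunction_eq_deriv_LSeries χ h1, DirichletCharacter.LFunction_eq_LSeries χ h1]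

end primeSide

/-! ## The integrand and the zeros in a compact set -/

/-- The integrand of the contour argument: `G_{f,s,χ}(w) = (−L'/L)(w, χ) · F₀(s − w)`.
[cite: HeathBrown1992PLMS, Lemma 5.1 (proof)] -/
def charEFIntegrand [NeZero q] (χ : DirichletCharacter ℂ q) (f : ℝ → ℝ) (s w : ℂ) : ℂ :=
  -(deriv χ.LFunction w / χ.LFunction w) * fordLaplace₀ f (s - w)

variable [NeZero q] {χ : DirichletCharacter ℂ q}

/-- The zeros of `L(s, χ)` (`χ ≠ χ₀`) in a compact set form a finite set (isolated zeros of an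
entire function which is not identically zero). [folklore] -/
theorem finite_inter_zeros_of_isCompact (hχ : χ ≠ 1) {K : Set ℂ} (hK : IsCompact K) :
    (K ∩ χ.LFunction ⁻¹' {0}).Finite := by
  have hcod := compl_zeros_LFunction_mem_codiscrete (χ := χ) hχ
  have hclosed : IsClosed (χ.LFunction ⁻¹' {0}) := by
    simpa using (mem_codiscrete'.mp hcod).1
  have hdisc : IsDiscrete (χ.LFunction ⁻¹' {0}) := by
    simpa using (mem_codiscrete'.mp hcod).2
  exact (hK.inter_right hclosed).finite (hdisc.mono inter_subset_right)

/-- For a primitive `χ` mod `q > 1`, a zero of `L(s, χ)` with `−5/2 ≤ Re ρ ≤ 3/2` has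
`−5/2 < Re ρ < 3/2` (the zeros are the non-trivial ones, `0 < Re ρ < 1`, and the trivial ones at
the integers `−2n − a ≤ 0`). [cite: MontgomeryVaughan2007, Corollary 10.8] -/
theorem re_mem_Ioo_of_zero_of_re_mem_Icc (hprim : χ.IsPrimitive) (hq : 1 < q) {ρ : ℂ}
    (hρ : χ.LFunction ρ = 0) (hre : ρ.re ∈ Icc (-(5 / 2) : ℝ) (3 / 2)) :
    ρ.re ∈ Ioo (-(5 / 2) : ℝ) (3 / 2) := by
  have hχ : χ ≠ 1 := ne_one_of_isPrimitive hprim hq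
  refine ⟨?_, ?_⟩
  · rcases lt_or_ge 0 ρ.re with h | h
    · linarith
    · -- a trivial zero: `Re ρ` is an integer
      by_contra hc
      have heq : ρ.re = -(5 / 2) := le_antisymm (not_lt.1 hc) hre.1
      have hγ : DirichletCharacter.gammaFactor χ ρ ≠ 0 := gammaFactor_ne_zero_of_not_int χ fun m hm ↦ by
        rw [heq] at hm
        have h2 : (2 : ℝ) * m = -5 := by linarith
        have h3 : (2 : ℤ) * m = -5 := by exact_mod_cast h2
        omega
      exact LFunction_ne_zero_of_re_nonpos_of_gammaFactor_ne_zero hprim hχ h hγ hρ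
  · by_contra h
    exact DirichletCharacter.LFunction_ne_zero_of_one_le_re χ (Or.inl hχ) (by push Not at h; linarith) hρ

/-! ## The contour identity -/

/-- **The residues of `(−L'/L)(w, χ) F₀(s − w)` in `[−5/2, 3/2] × [−T, T]`** (Heath-Brown 1992,
proof of Lemma 5.1, (5.6)–(5.7): "We move the line of integration to `Re w = −1/2` … the poles at
the zeros `ρ` contribute `−F₀((s−ρ)L)` … and the pole of `F₀` at `w = s` gives `−(L'/L)(s,χ)f(0)`",
here with the left line at `Re w = −5/2`). Let `χ` be primitive mod `q > 1`, `f` continuous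
vanishing on `[x₀, ∞)`, `−5/2 < Re s < 3/2` with `L(s, χ) ≠ 0`, `|Im s| < T`, and `T` a good
height (no non-trivial zero has ordinate `±T`). Then
`∮_{∂K} G = 2πi (−f(0) L'/L(s,χ) − Σ_{ρ ∈ K, L(ρ,χ)=0} m(ρ) F₀(s − ρ))`, `m = DirichletDisc.zeroOrder χ`,
the sum over ALL zeros of `L(·, χ)` in the closed rectangle `K` (Mathlib's four-term boundary
convention). [cite: HeathBrown1992PLMS, Lemma 5.1 (proof, (5.6)–(5.7))] -/
theorem charEF_contour_identity (hprim : χ.IsPrimitive) (hq : 1 < q) {f : ℝ → ℝ} {x₀ : ℝ}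
    (hfc : Continuous f) (hx₀ : 0 ≤ x₀) (hf0 : ∀ u, x₀ ≤ u → f u = 0) {s : ℂ}
    (hσ₁ : -(5 / 2) < s.re) (hσ₂ : s.re < 3 / 2) (hLs : χ.LFunction s ≠ 0) {T : ℝ}
    (hsT : |s.im| < T)
    (hgood : ∀ ρ : ℂ, χ.LFunction ρ = 0 → ρ.im ≠ 0 → ρ.im ≠ T ∧ ρ.im ≠ -T) :
    Literature.Analysis.Complex.rectBoundaryIntegral (charEFIntegrand χ f s) (-(5 / 2)) (3 / 2) (-T) T =
      2 * π * I * (-(f 0 : ℂ) * (deriv χ.LFunction s / χ.LFunction s) -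
        ∑ ρ ∈ (finite_inter_zeros_of_isCompact (ne_one_of_isPrimitive hprim hq)
            ((isCompact_Icc (a := -(5 / 2 : ℝ)) (b := 3 / 2)).reProdIm
              (isCompact_Icc (a := -T) (b := T)))).toFinset,
          (DirichletDisc.zeroOrder χ ρ : ℂ) * fordLaplace₀ f (s - ρ)) := by
  classical
  have hχ : χ ≠ 1 := ne_one_of_isPrimitive hprim hq
  have hT0 : 0 < T := (abs_nonneg _).trans_lt hsT
  have hab : (-(5 / 2) : ℝ) < 3 / 2 := by norm_num
  have hcd : -T < T := by linarith
  set Lf : ℂ → ℂ := χ.LFunction with hLf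
  have hLd : Differentiable ℂ Lf := DirichletCharacter.differentiable_LFunction hχ
  have hLan : ∀ w, AnalyticAt ℂ Lf w := fun w ↦ hLd.analyticAt w
  -- differentiability of `F`, `F₀`
  have hFd := differentiable_fordLaplace hfc hx₀ hf0
  have hF₀d : ∀ w : ℂ, w ≠ s → DifferentiableAt ℂ (fun w ↦ fordLaplace₀ f (s - w)) w := fun w hw ↦
    (differentiableAt_fordLaplace₀ hfc hx₀ hf0 (sub_ne_zero.2 (Ne.symm hw))).comp w
      ((differentiableAt_const _).sub differentiableAt_id)
  -- the zeros inside
  set K : Set ℂ := Icc (-(5 / 2) : ℝ) (3 / 2) ×ℂ Icc (-T) T with hK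
  have hKc : IsCompact K := (isCompact_Icc).reProdIm isCompact_Icc
  have hZfin := finite_inter_zeros_of_isCompact hχ hKc
  set Zf : Finset ℂ := hZfin.toFinset with hZf
  have hmemZf : ∀ {ρ : ℂ}, ρ ∈ Zf ↔ ρ ∈ K ∧ Lf ρ = 0 := by
    intro ρ
    rw [hZf, Set.Finite.mem_toFinset]
    rfl
  have hZf_prop : ∀ ρ ∈ Zf, Lf ρ = 0 ∧ ρ ≠ s ∧ ρ.re ∈ Ioo (-(5 / 2) : ℝ) (3 / 2) ∧
      -T < ρ.im ∧ ρ.im < T := by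
    intro ρ hρ
    obtain ⟨hρK, hρ0⟩ := hmemZf.1 hρ
    rw [hK, Complex.mem_reProdIm] at hρK
    refine ⟨hρ0, fun h ↦ hLs (h ▸ hρ0), re_mem_Ioo_of_zero_of_re_mem_Icc hprim hq hρ0 hρK.1, ?_, ?_⟩
    · rcases (hρK.2.1).lt_or_eq with h | h
      · exact h
      · exfalso
        have him : ρ.im ≠ 0 := by rw [← h]; linarith
        exact (hgood ρ hρ0 him).2 h.symm
    · rcases (hρK.2.2).lt_or_eq with h | h
      · exact h
      · exfalso
        have him : ρ.im ≠ 0 := by rw [h]; exact hT0.ne'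
        exact (hgood ρ hρ0 him).1 h
  -- the pole set
  have hsZ : s ∉ Zf := fun h ↦ (hZf_prop s h).2.1 rfl
  set S : Finset ℂ := insert s Zf with hS
  have hmemS : ∀ {p : ℂ}, p ∈ S ↔ p = s ∨ p ∈ Zf := by
    intro p
    simp [hS]
  -- the residues
  set r : ℂ → ℂ := fun p ↦ if p = s then -(f 0 : ℂ) * (deriv Lf s / Lf s) else
      -(DirichletDisc.zeroOrder χ p : ℂ) * fordLaplace₀ f (s - p) with hr
  have hrs : r s = -(f 0 : ℂ) * (deriv Lf s / Lf s) := by simp [hr]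
  have hrZ : ∀ ρ : ℂ, ρ ≠ s → r ρ = -(DirichletDisc.zeroOrder χ ρ : ℂ) * fordLaplace₀ f (s - ρ) := by
    intro ρ hρs
    simp [hr, hρs]
  have hlogd : ∀ z : ℂ, Lf z ≠ 0 → DifferentiableAt ℂ (logDeriv Lf) z := fun z hz ↦
    ((hLan z).deriv.div (hLan z) hz).differentiableAt
  -- the open set
  set U : Set ℂ := {w : ℂ | Lf w ≠ 0} ∪ (S : Set ℂ) with hU
  have hUopen : IsOpen U := by
    rw [isOpen_iff_mem_nhds]
    intro w hw
    by_cases hLw : Lf w = 0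
    · have hwS : w ∈ (S : Set ℂ) := by
        rcases hw with h | h
        · exact absurd hLw h
        · exact h
      rcases (hLan w).eventually_eq_zero_or_eventually_ne_zero with h | h
      · exact absurd (analyticOrderAt_eq_top.2 h) (DirichletDisc.analyticOrderAt_LFunction_ne_top χ hχ w)
      · rw [eventually_nhdsWithin_iff] at h
        filter_upwards [h] with z hz
        by_cases hzw : z = w
        · exact Or.inr (hzw ▸ hwS)
        · exact Or.inl (hz hzw)
    · exact mem_of_superset ((isOpen_ne_fun hLd.continuous continuous_const).mem_nhds hLw)
        subset_union_left
  have hKU : K ⊆ U := by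
    intro w hw
    by_cases hLw : Lf w = 0
    · exact Or.inr (Finset.mem_coe.2 (hmemS.2 (Or.inr (hmemZf.2 ⟨hw, hLw⟩))))
    · exact Or.inl hLw
  have hSsub : (S : Set ℂ) ⊆ Ioo (-(5 / 2) : ℝ) (3 / 2) ×ℂ Ioo (-T) T := by
    intro p hp
    rcases hmemS.1 (Finset.mem_coe.1 hp) with rfl | hp
    · exact ⟨⟨hσ₁, hσ₂⟩, abs_lt.1 hsT⟩
    · obtain ⟨-, -, hre, hi1, hi2⟩ := hZf_prop p hp
      exact ⟨hre, ⟨hi1, hi2⟩⟩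
  -- differentiability off the poles
  have hGd : DifferentiableOn ℂ (charEFIntegrand χ f s) (U \ (S : Set ℂ)) := by
    intro w hw
    have hwS : w ∉ S := fun h ↦ hw.2 (Finset.mem_coe.2 h)
    have hLw : Lf w ≠ 0 := by
      rcases hw.1 with h | h
      · exact h
      · exact absurd h hw.2
    have hws : w ≠ s := fun h ↦ hwS (hmemS.2 (Or.inl h))
    exact ((((hLan w).deriv.differentiableAt).div (hLan w).differentiableAt hLw).neg.mul
      (hF₀d w hws)).differentiableWithinAt
  -- apply the residue theorem
  have key := Literature.Analysis.Complex.rectBoundaryIntegral_eq_sum_of_simplePoles hab hcd S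
    (charEFIntegrand χ f s) r U hUopen (by rw [← hK]; exact hKU) hSsub hGd ?poles
  case poles =>
    intro p hp
    rcases hmemS.1 hp with rfl | hp
    · -- the pole at `s`
      refine ⟨fun z ↦ -logDeriv Lf z * (fordLaplace f (p - z) * (z - p) + f 0),
        {z : ℂ | Lf z ≠ 0}, ?_, ?_, ?_, ?_⟩
      · exact (isOpen_ne_fun hLd.continuous continuous_const).mem_nhds hLs
      · intro z hz
        have hd1 : DifferentiableAt ℂ (fun z : ℂ ↦ -logDeriv Lf z) z := (hlogd z hz).neg
        have hd2 : DifferentiableAt ℂ (fun z : ℂ ↦ fordLaplace f (p - z) * (z - p) + f 0) z :=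
          (((hFd (p - z)).comp z ((differentiableAt_const _).sub differentiableAt_id)).mul
            (differentiableAt_id.sub_const p)).add (differentiableAt_const _)
        exact (hd1.mul hd2).differentiableWithinAt
      · simp only [hrs, sub_self, mul_zero, zero_add, logDeriv_apply]
        ring
      · intro z _ hzs
        dsimp only
        rw [charEFIntegrand, fordLaplace₀, logDeriv_apply]
        have h1 : z - p ≠ 0 := sub_ne_zero.2 hzs
        have h2 : p - z ≠ 0 := sub_ne_zero.2 (Ne.symm hzs)
        field_simp
        ring
    · -- the pole at a zero `ρ`
      obtain ⟨hLp, hps, -, -, -⟩ := hZf_prop p hp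
      obtain ⟨B, hB, hev⟩ := exists_analyticAt_logDeriv_eq_add (hLan p)
        (DirichletDisc.analyticOrderAt_LFunction_ne_top χ hχ p)
      set m : ℕ := analyticOrderNatAt Lf p with hm
      have hmcast : (m : ℂ) = (DirichletDisc.zeroOrder χ p : ℂ) := by
        rw [hm, DirichletDisc.zeroOrder]
      have hall : ∀ᶠ z in 𝓝 p, (z ≠ p → Lf z ≠ 0 ∧ deriv Lf z / Lf z = (m : ℂ) / (z - p) + B z) ∧
          DifferentiableAt ℂ B z ∧ z ≠ s := by
        rw [eventually_nhdsWithin_iff] at hev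
        filter_upwards [hev, hB.eventually_analyticAt, isOpen_ne.eventually_mem hps] with z h1 h2 h3
        exact ⟨h1, h2.differentiableAt, h3⟩
      obtain ⟨V, hVsub, hVopen, hpV⟩ := mem_nhds_iff.1 hall
      refine ⟨fun z ↦ -B z * fordLaplace₀ f (s - z) * (z - p)
          - (m : ℂ) * fordLaplace₀ f (s - z), V, hVopen.mem_nhds hpV, ?_, ?_, ?_⟩
      · intro z hz
        obtain ⟨-, hBd, hzs⟩ := hVsub hz
        have hd2 := hF₀d z hzs
        exact (((hBd.neg.mul hd2).mul (differentiableAt_id.sub_const p)).sub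
          ((differentiableAt_const _).mul hd2)).differentiableWithinAt
      · simp only [hrZ p hps, sub_self, mul_zero, zero_sub, hmcast, neg_mul]
      · intro z hz hzp
        obtain ⟨h1, -, -⟩ := hVsub hz
        obtain ⟨hLz, hLdz⟩ := h1 hzp
        rw [charEFIntegrand, hLdz]
        have h3 : z - p ≠ 0 := sub_ne_zero.2 hzp
        field_simp
        ring
  rw [key]
  congr 1
  rw [hS, Finset.sum_insert hsZ, hrs]
  have hrZ' : ∀ ρ ∈ Zf, r ρ = -(DirichletDisc.zeroOrder χ ρ : ℂ) * fordLaplace₀ f (s - ρ) := fun ρ hρ ↦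
    hrZ ρ (hZf_prop ρ hρ).2.1
  rw [Finset.sum_congr rfl hrZ']
  simp only [neg_mul, Finset.sum_neg_distrib, hLf]
  ring

end ExplicitPsiChar

end Literature.NumberTheory.LFunctions

end
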